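import Literature.Geometry.Manifold.MaximalIntegralCurve
import HarnessLib

/-!
# The maximal flow of a `C^n` vector field is `C^n` on its open domain (Lee 2012, Thm. 9.12 (c)–(d))

General differential topology, sequel to `Literature.Geometry.Manifold.MaximalIntegralCurve`
(`exists_maximalFlow`: the maximal flow `Θ : M → ℝ → M`, `D : M → Set ℝ` of a `C^n` field with its
group law and its `C^n` regularity NEAR `t = 0`). Here the regularity is spread along whole orbits:

* `Literature.Geometry.Manifold.isOpen_contMDiffOn_of_flow` — for any family `Θ, D` of curves on
  open intervals `D x ∋ 0` satisfying the **group law** `D (Θ x s) = D x - s`,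
  `Θ (Θ x s) t = Θ x (t + s)` and **local regularity near `t = 0`** about every point, the flow
  domain `𝒟 = {(x, t) | t ∈ D x}` is OPEN in `M × ℝ` and `(x, t) ↦ Θ x t` is `C^n` on `𝒟`
  (Lee 2012, Thm. 9.12 (c) "`𝒟` is open" and (d) "`θ` is smooth on `𝒟`"; Bröcker–Jänich 1982,
  (8.11)). Proof (Bröcker–Jänich, proof of (8.11), "`J_x` is open, non-empty and closed"): for
  fixed `x₁` the set of times `t ∈ D x₁` about which `𝒟` is a neighbourhood of `(x₁, t)` carrying
  `Θ` as a `C^n` map is open, contains `0`, and is closed in the interval `D x₁`: for a limit time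
  `t*` take the local box `U × (-ε, ε)` at `Θ x₁ t*`, a good time `t₁` within `ε/2` of `t*` with
  `Θ x₁ t₁ ∈ U`, and write `Θ x t = Θ (Θ x t₁) (t - t₁)` near `(x₁, t*)` by the group law.
* `Literature.Geometry.Manifold.eventually_mem_and_apply_mem_of_flow` — the time-slice form of
  openness + continuity: for `t ∈ D x₀` and `Θ x₀ t ∈ O` open, nearby `x` have `t ∈ D x`,
  `Θ x t ∈ O`.
* `Literature.Geometry.Manifold.exists_maximalFlow_contMDiffOn` — `exists_maximalFlow` with these
  two conclusions added (the full statement of Lee 2012, Thm. 9.12 (a)–(d)), and the continuity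
  corollary `Literature.Geometry.Manifold.exists_maximalFlow_continuousOn`.

Everything is proved; no definitions, no named facts. Consumer: the retraction of a globally
hyperbolic spacetime onto a Cauchy hypersurface along the integral curves of a time orientation
(O'Neill 1983, Ch. 14, Prop. 14.31; the topological half of Penrose's singularity theorem,
`Literature.Geometry.Lorentzian.PenroseSingularityTheoremProofs`).

## References

* J. M. Lee, *Introduction to Smooth Manifolds*, 2nd ed., GTM 218 (2012), Thm. 9.12
  (fundamental theorem on flows). [LeeSmoothManifolds2013]
* Th. Bröcker, K. Jänich, *Introduction to Differential Topology*, CUP 1982, (8.11).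
  [BrockerJanichIDT1982]
-/

open scoped Manifold ContDiff Topology
open Set Function Filter Metric

noncomputable section

namespace Literature.Geometry.Manifold

universe u

variable {E : Type u} [NormedAddCommGroup E] [NormedSpace ℝ E]
  {H : Type*} [TopologicalSpace H] {I : ModelWithCorners ℝ E H}
  {M : Type*} [TopologicalSpace M] [ChartedSpace H M]
  {V : Π x : M, TangentSpace I x} {n : ℕ∞}

/-- **The flow domain is open and the flow is `C^n` on it** (Lee 2012, Thm. 9.12 (c)–(d);
Bröcker–Jänich 1982, (8.11)). Let `Θ x` be an integral curve of `V` on the open interval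
`D x ∋ 0` through `x = Θ x 0`, for every `x`, and assume the group law
`D (Θ x s) = {t | t + s ∈ D x}`, `Θ (Θ x s) t = Θ x (t + s)` (`s ∈ D x`) and local `C^n`
regularity near `t = 0` about every point (as provided by `exists_maximalFlow`). Then
`{(x, t) | t ∈ D x}` is open and `(x, t) ↦ Θ x t` is `C^n` there. [cite: LeeSmoothManifolds2013, Thm. 9.12 (c)–(d)] -/
theorem isOpen_contMDiffOn_of_flow {Θ : M → ℝ → M} {D : M → Set ℝ}
    (hD : ∀ x, IsOpen (D x) ∧ (D x).OrdConnected ∧ 0 ∈ D x ∧ IsMIntegralCurveOn (Θ x) V (D x))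
    (hgrp : ∀ x, ∀ s ∈ D x, D (Θ x s) = {t | t + s ∈ D x} ∧
      ∀ t, t + s ∈ D x → Θ (Θ x s) t = Θ x (t + s))
    (hloc : ∀ x₀, ∃ U : Set M, IsOpen U ∧ x₀ ∈ U ∧ ∃ ε > (0 : ℝ), (∀ x ∈ U, Ioo (-ε) ε ⊆ D x) ∧
      ContMDiffOn (I.prod 𝓘(ℝ, ℝ)) I n (fun p : M × ℝ => Θ p.1 p.2) (U ×ˢ Ioo (-ε) ε)) :
    IsOpen {p : M × ℝ | p.2 ∈ D p.1} ∧
      ContMDiffOn (I.prod 𝓘(ℝ, ℝ)) I n (fun p : M × ℝ => Θ p.1 p.2) {p : M × ℝ | p.2 ∈ D p.1} := by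
  set F : M × ℝ → M := fun p => Θ p.1 p.2 with hF
  set 𝒟 : Set (M × ℝ) := {p : M × ℝ | p.2 ∈ D p.1} with h𝒟
  -- the good points: `𝒟` is a neighbourhood on which `F` is `C^n`
  suffices key : ∀ (x₁ : M), ∀ t ∈ D x₁, ∃ W : Set (M × ℝ), IsOpen W ∧ (x₁, t) ∈ W ∧ W ⊆ 𝒟 ∧
      ContMDiffOn (I.prod 𝓘(ℝ, ℝ)) I n F W by
    refine ⟨isOpen_iff_forall_mem_open.2 ?_, ?_⟩
    · rintro ⟨x₁, t⟩ ht
      obtain ⟨W, hWo, hW, hW𝒟, -⟩ := key x₁ t ht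
      exact ⟨W, hW𝒟, hWo, hW⟩
    · rintro ⟨x₁, t⟩ ht
      obtain ⟨W, hWo, hW, -, hFW⟩ := key x₁ t ht
      exact ((hFW _ hW).contMDiffAt (hWo.mem_nhds hW)).contMDiffWithinAt
  intro x₁
  set S : Set ℝ := {t | ∃ W : Set (M × ℝ), IsOpen W ∧ (x₁, t) ∈ W ∧ W ⊆ 𝒟 ∧
      ContMDiffOn (I.prod 𝓘(ℝ, ℝ)) I n F W} with hS
  suffices hsub : D x₁ ⊆ S from fun t ht => hsub ht
  -- `S` is open
  have hSo : IsOpen S := by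
    rw [isOpen_iff_mem_nhds]
    rintro t ⟨W, hWo, htW, hW𝒟, hFW⟩
    have hmem : {s : ℝ | (x₁, s) ∈ W} ∈ 𝓝 t :=
      (hWo.preimage (continuous_const.prodMk continuous_id)).mem_nhds htW
    filter_upwards [hmem] with s hs
    exact ⟨W, hWo, hs, hW𝒟, hFW⟩
  -- `0 ∈ S`
  have hS0 : (0 : ℝ) ∈ S := by
    obtain ⟨U, hUo, hx₁U, ε, hε, hUD, hsm⟩ := hloc x₁
    refine ⟨U ×ˢ Ioo (-ε) ε, hUo.prod isOpen_Ioo, ⟨hx₁U, ⟨by linarith, hε⟩⟩, ?_, hsm⟩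
    rintro ⟨x, t⟩ ⟨hx, ht⟩
    exact hUD x hx ht
  -- `S` is closed in `D x₁`
  have hSc : closure S ∩ D x₁ ⊆ S := by
    rintro tstar ⟨htstar, htD⟩
    obtain ⟨U, hUo, hpU, ε, hε, hUD, hsm⟩ := hloc (Θ x₁ tstar)
    -- the orbit of `x₁` stays in `U` for times near `tstar`
    have hcont : ContinuousAt (Θ x₁) tstar :=
      ((hD x₁).2.2.2.hasMFDerivAt_of_isOpen (hD x₁).1 htD).continuousAt
    obtain ⟨δ, hδ, hδU⟩ : ∃ δ > (0 : ℝ), ∀ s, dist s tstar < δ → Θ x₁ s ∈ U := by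
      have hpre : (Θ x₁) ⁻¹' U ∈ 𝓝 tstar := hcont.preimage_mem_nhds (hUo.mem_nhds hpU)
      obtain ⟨δ, hδ, hball⟩ := Metric.mem_nhds_iff.1 hpre
      exact ⟨δ, hδ, fun s hs => hball hs⟩
    -- a good time `t₁` close to `tstar`
    obtain ⟨t₁, ht₁S, ht₁⟩ :=
      Metric.mem_closure_iff.1 htstar (min δ (ε / 2)) (lt_min hδ (half_pos hε))
    obtain ⟨W₁, hW₁o, hW₁, hW₁𝒟, hFW₁⟩ := ht₁S
    have hd1 : dist t₁ tstar < δ := by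
      rw [dist_comm]; exact lt_of_lt_of_le ht₁ (min_le_left _ _)
    have hd2 : |tstar - t₁| < ε / 2 := by
      rw [← Real.dist_eq]; exact lt_of_lt_of_le ht₁ (min_le_right _ _)
    -- `x ↦ Θ x t₁` is `C^n` near `x₁`, and `t₁ ∈ D x` there
    set V₁ : Set M := {x | (x, t₁) ∈ W₁} with hV₁
    have hV₁o : IsOpen V₁ := hW₁o.preimage (continuous_id.prodMk continuous_const)
    have hx₁V₁ : x₁ ∈ V₁ := hW₁
    have hV₁D : ∀ x ∈ V₁, t₁ ∈ D x := fun x hx => hW₁𝒟 hx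
    have hG : ContMDiffOn I I n (fun x => Θ x t₁) V₁ :=
      hFW₁.comp (contMDiffOn_id.prodMk contMDiffOn_const) fun x hx => hx
    have hGc : ContinuousOn (fun x => Θ x t₁) V₁ := hG.continuousOn
    -- the neighbourhood of `(x₁, tstar)` on which `Θ x t = Θ (Θ x t₁) (t - t₁)`
    set W : Set (M × ℝ) := (V₁ ∩ (fun x => Θ x t₁) ⁻¹' U) ×ˢ Ioo (t₁ - ε) (t₁ + ε) with hW
    have hWo : IsOpen W := (hGc.isOpen_inter_preimage hV₁o hUo).prod isOpen_Ioo
    have hmemW : (x₁, tstar) ∈ W := by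
      refine ⟨⟨hx₁V₁, ?_⟩, ?_⟩
      · exact hδU t₁ hd1
      · rw [abs_lt] at hd2
        constructor <;> linarith
    -- `W ⊆ 𝒟` by the group law for the domains
    have hW𝒟 : W ⊆ 𝒟 := by
      rintro ⟨x, t⟩ ⟨⟨hxV₁, hxU⟩, ht1, ht2⟩
      have ht₁D : t₁ ∈ D x := hV₁D x hxV₁
      have hsub : Ioo (-ε) ε ⊆ D (Θ x t₁) := hUD _ hxU
      have hmem : t - t₁ ∈ D (Θ x t₁) := hsub ⟨by linarith, by linarith⟩
      rw [(hgrp x t₁ ht₁D).1] at hmem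
      show t ∈ D x
      simpa using hmem
    refine ⟨W, hWo, hmemW, hW𝒟, ?_⟩
    have hinner : ContMDiffOn (I.prod 𝓘(ℝ, ℝ)) (I.prod 𝓘(ℝ, ℝ)) n
        (fun q : M × ℝ => (Θ q.1 t₁, q.2 - t₁)) W := by
      refine ContMDiffOn.prodMk ?_ ?_
      · exact hG.comp contMDiffOn_fst fun q hq => hq.1.1
      · exact (contDiff_id.sub contDiff_const).contMDiff.comp_contMDiffOn contMDiffOn_snd
    have hcomp := hsm.comp hinner fun q hq => by
      obtain ⟨⟨-, hq1⟩, hq2, hq3⟩ := hq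
      exact ⟨hq1, ⟨by linarith, by linarith⟩⟩
    refine hcomp.congr fun q hq => ?_
    have ht₁D : t₁ ∈ D q.1 := hV₁D q.1 hq.1.1
    have hq𝒟 : q.2 ∈ D q.1 := hW𝒟 hq
    show Θ q.1 q.2 = Θ (Θ q.1 t₁) (q.2 - t₁)
    rw [(hgrp q.1 t₁ ht₁D).2 (q.2 - t₁) (by simpa using hq𝒟), sub_add_cancel]
  -- `D x₁` is connected, `S` is relatively clopen in it and meets it
  exact ((hD x₁).2.1.isPreconnected).subset_of_closure_inter_subset hSo ⟨0, (hD x₁).2.2.1, hS0⟩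
    hSc

/-- **Neighbouring orbits at a fixed time.** If the flow domain `{(x, t) | t ∈ D x}` is open and
`(x, t) ↦ Θ x t` is continuous on it, then for `t ∈ D x₀` with `Θ x₀ t` in an open set `O`, all
`x` near `x₀` have `t ∈ D x` and `Θ x t ∈ O` (continuity of `x ↦ (x, t)` into the open domain).
Lee 2012, Thm. 9.12 (c)–(d), in the form used along single time slices. [folklore] -/
theorem eventually_mem_and_apply_mem_of_flow {Θ : M → ℝ → M} {D : M → Set ℝ}
    (hopen : IsOpen {p : M × ℝ | p.2 ∈ D p.1})
    (hcont : ContinuousOn (fun p : M × ℝ => Θ p.1 p.2) {p : M × ℝ | p.2 ∈ D p.1})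
    {x₀ : M} {t : ℝ} (ht : t ∈ D x₀) {O : Set M} (hO : IsOpen O) (hmem : Θ x₀ t ∈ O) :
    ∀ᶠ x in 𝓝 x₀, t ∈ D x ∧ Θ x t ∈ O := by
  have hc : Continuous (fun x : M => (x, t)) := continuous_id.prodMk continuous_const
  have e1 : ∀ᶠ x in 𝓝 x₀, (x, t) ∈ {p : M × ℝ | p.2 ∈ D p.1} :=
    hc.continuousAt.preimage_mem_nhds (hopen.mem_nhds ht)
  have hFc : ContinuousAt (fun p : M × ℝ => Θ p.1 p.2) (x₀, t) :=
    hcont.continuousAt (hopen.mem_nhds ht)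
  have e2 : ∀ᶠ x in 𝓝 x₀, Θ x t ∈ O :=
    (hFc.comp_of_eq hc.continuousAt rfl).preimage_mem_nhds (hO.mem_nhds hmem)
  exact e1.and e2

variable [CompleteSpace E] [IsManifold I ∞ M] [T2Space M] [BoundarylessManifold I M]

/-- **The fundamental theorem on flows** (Lee 2012, Thm. 9.12 (a)–(d)), existential form: the
maximal flow `Θ, D` of a `C^n` vector field (`1 ≤ n`) on a Hausdorff manifold without boundary —
maximal integral curves through every point, group law, local regularity
(`exists_maximalFlow`) — has, in addition, OPEN domain `{(x, t) | t ∈ D x}` on which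
`(x, t) ↦ Θ x t` is `C^n` (`isOpen_contMDiffOn_of_flow`). [cite: LeeSmoothManifolds2013, Thm. 9.12] -/
theorem exists_maximalFlow_contMDiffOn
    (hV : ContMDiff I I.tangent n fun x => (⟨x, V x⟩ : TangentBundle I M)) (hn : 1 ≤ n) :
    ∃ (Θ : M → ℝ → M) (D : M → Set ℝ),
      (∀ x, IsOpen (D x) ∧ (D x).OrdConnected ∧ 0 ∈ D x ∧ Θ x 0 = x ∧
        IsMIntegralCurveOn (Θ x) V (D x) ∧
        ∀ (γ : ℝ → M) (J : Set ℝ), IsOpen J → J.OrdConnected → ∀ t₀ ∈ J, t₀ ∈ D x →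
          γ t₀ = Θ x t₀ → IsMIntegralCurveOn γ V J → J ⊆ D x ∧ EqOn γ (Θ x) J) ∧
      (∀ x, ∀ s ∈ D x, D (Θ x s) = {t | t + s ∈ D x} ∧
        ∀ t, t + s ∈ D x → Θ (Θ x s) t = Θ x (t + s)) ∧
      IsOpen {p : M × ℝ | p.2 ∈ D p.1} ∧
      ContMDiffOn (I.prod 𝓘(ℝ, ℝ)) I n (fun p : M × ℝ => Θ p.1 p.2) {p : M × ℝ | p.2 ∈ D p.1} := by
  obtain ⟨Θ, D, hΘ, hgrp, hloc⟩ := exists_maximalFlow (I := I) hV hn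
  obtain ⟨hopen, hsmooth⟩ := isOpen_contMDiffOn_of_flow (I := I) (n := n)
    (fun x => ⟨(hΘ x).1, (hΘ x).2.1, (hΘ x).2.2.1, (hΘ x).2.2.2.2.1⟩) hgrp hloc
  exact ⟨Θ, D, hΘ, hgrp, hopen, hsmooth⟩

/-- **The maximal flow is continuous on its open domain** (Lee 2012, Thm. 9.12 (c)–(d), the
continuity part): for a `C¹` vector field on a Hausdorff manifold without boundary there are
`Θ, D` with `Θ x` the maximal integral curve on the open interval `D x ∋ 0` through `x`, the
group law, the domain `{(x, t) | t ∈ D x}` open and `(x, t) ↦ Θ x t` continuous on it.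
[cite: LeeSmoothManifolds2013, Thm. 9.12] -/
theorem exists_maximalFlow_continuousOn
    (hV : ContMDiff I I.tangent 1 fun x => (⟨x, V x⟩ : TangentBundle I M)) :
    ∃ (Θ : M → ℝ → M) (D : M → Set ℝ),
      (∀ x, IsOpen (D x) ∧ (D x).OrdConnected ∧ 0 ∈ D x ∧ Θ x 0 = x ∧
        IsMIntegralCurveOn (Θ x) V (D x) ∧
        ∀ (γ : ℝ → M) (J : Set ℝ), IsOpen J → J.OrdConnected → ∀ t₀ ∈ J, t₀ ∈ D x →
          γ t₀ = Θ x t₀ → IsMIntegralCurveOn γ V J → J ⊆ D x ∧ EqOn γ (Θ x) J) ∧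
      (∀ x, ∀ s ∈ D x, D (Θ x s) = {t | t + s ∈ D x} ∧
        ∀ t, t + s ∈ D x → Θ (Θ x s) t = Θ x (t + s)) ∧
      IsOpen {p : M × ℝ | p.2 ∈ D p.1} ∧
      ContinuousOn (fun p : M × ℝ => Θ p.1 p.2) {p : M × ℝ | p.2 ∈ D p.1} := by
  obtain ⟨Θ, D, hΘ, hgrp, hopen, hsmooth⟩ :=
    exists_maximalFlow_contMDiffOn (I := I) (n := 1) (by exact_mod_cast hV) le_rfl
  exact ⟨Θ, D, hΘ, hgrp, hopen, hsmooth.continuousOn⟩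

end Literature.Geometry.Manifold

end
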